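import Summits.CriticalPhenomena.PercolationContinuityZ3.Theorems.PercNearOneGluingNoHeavyLowerTailAntitheticUConeInvarianceTwo
import Summits.CriticalPhenomena.PercolationContinuityZ3.Theorems.PercNearOneGluingNoHeavyLowerTailAntitheticZoneSystem
import HarnessLib

/-!
# `NoHeavyLowerTail` (stmt-CriticalPhenomena-4575) — antithetic cluster pairs: THEOREM U — BIC for EVERY avoidance set `R` on every graph
# with a UNIVERSAL vertex `k₀ ≠ s` (prim-hp-2 gen 37; HOME/THEOREM-U-universal.md, MEMO-gen37 §4e)

Support file (`--supports stmt-CriticalPhenomena-4575`, hull-port prover `prim-hp-2`, gen 37).  No definitions, no named facts, no sorries;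
standard axioms.

SETTING (MEMO-gen29 §3, MEMO-gen31 §1): colourings `ω ⊆ Sym2 V` (`ω ∩ E` red, `ωᶜ ∩ E` blue), source `s`, red / blue edge clusters of `s`,
`Δ(ω) = (F(red) − F(blue))(G(red) − G(blue))` for increasing `F, G`; `BIC_E(R) = Σ_{ω : no r ∈ R joined to s in both colours} Δ(ω)`;
CONJECTURE BIC (gen 31): `BIC_E(R) ≥ 0` always.
* `Antithetic.univCone_bic_nonneg` — THEOREM U: if some `k₀ ≠ s` is adjacent to every other vertex then `BIC_E(R) ≥ 0` for every `R`.
  With THEOREM I (`s` universal, `Antithetic.cone_bic_nonneg`) this settles CONJECTURE BIC on EVERY GRAPH WITH A UNIVERSAL VERTEX, for every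
  source and every avoidance set (wheels and fans from any vertex, `K_n` minus any edges missing the apex, any graph with an added apex …).
  Found by the gen-37 rule census (HOME/code/gen37/lab37/univtest.py, classL.py: 0 failures); the clique hypothesis of the first paper version
  turned out to be unnecessary in the formal proof.
PROOF: the zone-system theorem `Antithetic.zoneSystem_bic_nonneg` with the zone system of `…UConeZones` (reached `r` ↦ its cluster of the
non-reaching colour; unreached `r` ↦ the hub cluster of `k₀` if it contains a reached `R`-vertex, else the own cluster of `r`), whose
hypotheses are `UCone.mem_zone_self`, `UCone.source_not_mem_zone`, `UCone.boundary`, `UCone.consistent` (…UConeConsistency) and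
`UCone.invariance` (…UConeInvarianceTwo).
[cite: VandenbergHaggstromKahn2005, §1 p. 6 ("Harris' inequality"), §1 p. 3 (open cluster `C_s`)]
-/

noncomputable section

namespace Summit.CriticalPhenomena.PercolationContinuityZ3.Theorems

open Literature.Probability.Percolation
open scoped Classical symmDiff

namespace Antithetic

section TheoremU

variable {V : Type*} [Fintype V]

/-- **THEOREM U (prim-hp-2 gen 37): BIC with a universal vertex.**  `E` an edge set on a finite vertex type, `s` a source, `k₀ ≠ s` a
vertex adjacent (in `E`) to every other vertex.  Then for every vertex set `R` and all increasing `F, G` of the edge cluster,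
`0 ≤ Σ_{ω : no r ∈ R is joined to s both in ω ∩ E and in ωᶜ ∩ E} (F(C_s(ω∩E)) − F(C_s(ωᶜ∩E))) · (G(C_s(ω∩E)) − G(C_s(ωᶜ∩E)))`. [this work] -/
theorem univCone_bic_nonneg (E : Set (Sym2 V)) (s k₀ : V) (hk : k₀ ≠ s) (huniv : ∀ v, v ≠ k₀ → s(k₀, v) ∈ E)
    (R : Set V) {F G : Set (Sym2 V) → ℝ} (hF : Monotone F) (hG : Monotone G) :
    0 ≤ ∑ ω ∈ Finset.univ.filter (fun ω : Set (Sym2 V) =>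
        ∀ r ∈ R, ¬ ((openGraph (ω ∩ E)).Reachable s r ∧ (openGraph (ωᶜ ∩ E)).Reachable s r)),
      (F (openEdgeCluster (ω ∩ E) s) - F (openEdgeCluster (ωᶜ ∩ E) s)) *
        (G (openEdgeCluster (ω ∩ E) s) - G (openEdgeCluster (ωᶜ ∩ E) s)) := by
  exact zoneSystem_bic_nonneg E s R (fun T r => UCone.zone E s k₀ R T r) (fun T r => r ∈ UCone.beta E s k₀ R T)
    (fun _ _ _ _ => UCone.mem_zone_self) (fun _ hT u hu => UCone.source_not_mem_zone hk huniv (hT u hu))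
    (fun _ hT u hu _ hx _ hy hxy => UCone.boundary hk huniv (hT u hu) hx hy hxy)
    (fun _ hT _ hu _ hv e heu hev => UCone.consistent hk huniv hT hu hv (e := e) heu hev)
    (fun _ hT _ hM hag => UCone.invariance hk huniv hT hM hag) hF hG

end TheoremU

end Antithetic

end Summit.CriticalPhenomena.PercolationContinuityZ3.Theorems
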